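import Mathlib
import HarnessLib
import Summits.Parity.GeneralizedHardyLittlewood.Theorems.TelescopingWindowsLatticeDefs
import Literature.NumberTheory.Sieve.LinearEquationsInPrimesLocalObstruction

/-!
# TelescopingWindows (route rev 2) — lattice-shift DICTIONARY and the T15 CERTIFICATE (guard G2)
(decomp-parity cell, lens-4 g6; hand-ready extract of the cell kernel `TelescopingWindowsLattice.lean`; the five
abbreviations `hlError` / `shiftConst` / `windowLen` / `strideMod` / `latticeWindow` live in the route-independent
`Theorems/TelescopingWindowsLatticeDefs.lean`, D-0009; this file imports no route file).  For a non-degenerate system `Ψ` with `‖Ψ‖_N ≤ L` and a shift `j` with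
`primorial (max t L) ∣ j`:  `0 < 𝔖(Ψ) ↔ 0 < 𝔖(Ψ^{(i,j)})` (`singularProduct_pos_iff_shiftConst`): primes
`p ≤ max t L` divide `j`, so `β_p` is unchanged (`localFactor_shiftConst_eq`); primes `p > max t L` obstruct no
system of `t < p` non-constant forms with coefficients `0 < |ψ̇| ≤ L < p` (`localFactor_pos_of_lt`).  Hence the
trap T15 «obstructed neighbours» (CRITIC-LEDGER rows 56/57) has no instance on the lattice, in either direction
(`no_obstructed_comparand`, `no_admissible_comparand_of_obstructed`).  §3: the lattice window and the size bound
`‖Ψ^{(i,j)}‖_N ≤ L + 1` for its members (used by the necessity file `TelescopingWindowsLatticeNecessity`).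
-/

namespace Summit.Parity.GeneralizedHardyLittlewood.TelescopingWindowsLatticeShift

open Finset
open Literature.NumberTheory.Sieve hiding GeneralizedHardyLittlewood
noncomputable section

/-! ## §1 Dictionary: basic identities of the constant-term shift -/

/-- Shifting a constant term leaves every coefficient vector unchanged. -/
theorem shiftConst_apply_coeff {d t : ℕ} (Ψ : Fin t → AffLinForm d) (i i' : Fin t) (j : ℤ) :
    (shiftConst Ψ i j i').coeff = (Ψ i').coeff := by
  unfold shiftConst
  rcases eq_or_ne i' i with rfl | h
  · rw [Function.update_self]
  · rw [Function.update_of_ne h]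

/-- The constant terms of `Ψ^{(i,j)}`: `+ j` at `i`, unchanged elsewhere. -/
theorem shiftConst_apply_const {d t : ℕ} (Ψ : Fin t → AffLinForm d) (i i' : Fin t) (j : ℤ) :
    (shiftConst Ψ i j i').const = (Ψ i').const + if i' = i then j else 0 := by
  unfold shiftConst
  rcases eq_or_ne i' i with rfl | h
  · rw [Function.update_self, if_pos rfl]
  · rw [Function.update_of_ne h, if_neg h, add_zero]

/-- `Ψ^{(i,0)} = Ψ`. -/
@[simp] theorem shiftConst_zero {d t : ℕ} (Ψ : Fin t → AffLinForm d) (i : Fin t) :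
    shiftConst Ψ i 0 = Ψ := by
  unfold shiftConst
  rw [Function.update_eq_self_iff]
  ext <;> simp

/-- `Ψ^{(i,j)}(m) = Ψ(m) + j·[i' = i]`. -/
theorem eval_shiftConst {d t : ℕ} (Ψ : Fin t → AffLinForm d) (i i' : Fin t) (j : ℤ)
    (m : Fin d → ℤ) :
    (shiftConst Ψ i j i').eval m = (Ψ i').eval m + if i' = i then j else 0 := by
  simp only [AffLinForm.eval, shiftConst_apply_coeff, shiftConst_apply_const]
  split_ifs <;> ring

/-! ## §2 The G2 certificate: lattice shifts preserve admissibility EXACTLY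

For a prime `p ∣ j` the local factors of `Ψ` and `Ψ^{(i,j)}` coincide; a prime `p > max(t, L)`
obstructs no system of `t` non-constant forms with coefficients bounded by `L`; hence for
`primorial (max t L) ∣ j`:  `0 < 𝔖(Ψ) ↔ 0 < 𝔖(Ψ^{(i,j)})`. -/

/-- Local factors are invariant under shifts of one constant term by a multiple of `p`. -/
theorem localFactor_shiftConst_eq {d t : ℕ} {p : ℕ} (hp : p.Prime) (Ψ : Fin t → AffLinForm d)
    (i : Fin t) {j : ℤ} (hj : (p : ℤ) ∣ j) :
    localFactor (shiftConst Ψ i j) p = localFactor Ψ p := by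
  haveI : NeZero p := ⟨hp.ne_zero⟩
  have h0 : (((if True then j else 0 : ℤ)) : ZMod p) = 0 := by
    rw [if_pos trivial]
    exact (ZMod.intCast_zmod_eq_zero_iff_dvd j p).mpr hj
  unfold localFactor
  congr 1
  refine Finset.sum_congr rfl fun n _ => Finset.prod_congr rfl fun i' _ => ?_
  rw [eval_shiftConst, localVonMangoldt_prime hp, localVonMangoldt_prime hp]
  have h1 : (((Ψ i').eval (fun k => (n k : ℤ)) + (if i' = i then j else 0) : ℤ) : ZMod p)
      = (((Ψ i').eval (fun k => (n k : ℤ)) : ℤ) : ZMod p) := by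
    rw [Int.cast_add]
    split_ifs
    · rw [show ((j : ℤ) : ZMod p) = 0 from (ZMod.intCast_zmod_eq_zero_iff_dvd j p).mpr hj, add_zero]
    · rw [Int.cast_zero, add_zero]
  rw [h1]

/-- No local obstruction above `max(t, L)`: if every form has a coefficient that is a unit mod `p`
(here: all coefficients non-zero mod `p` as a vector) and `t < p`, then `g_p(Ψ) > 0`. -/
theorem goodCount_pos_of_lt {d t : ℕ} {p : ℕ} [hp : Fact p.Prime] (Ψ : Fin t → AffLinForm d)
    (hcoeff : ∀ i, (fun k => ((Ψ i).coeff k : ZMod p)) ≠ 0) (htp : t < p) :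
    0 < goodCount Ψ p := by
  classical
  set Z : Fin t → Finset (Fin d → ZMod p) :=
    fun i => Finset.univ.filter (fun v => (Ψ i).modEval p v = 0) with hZ
  have hZcard : ∀ i, (Z i).card * p = p ^ d := by
    intro i
    have h := card_modZero_mul (Ψ i) (hcoeff i)
    convert h using 2
  unfold goodCount
  rw [Finset.card_pos]
  by_contra hempty
  rw [Finset.not_nonempty_iff_eq_empty, Finset.filter_eq_empty_iff] at hempty
  have hcover : (Finset.univ : Finset (Fin d → ZMod p)) ⊆ Finset.univ.biUnion Z := by
    intro v _
    have hv := hempty (Finset.mem_univ v)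
    push Not at hv
    obtain ⟨i, hi⟩ := hv
    exact Finset.mem_biUnion.mpr ⟨i, Finset.mem_univ i, by
      rw [hZ, Finset.mem_filter]
      exact ⟨Finset.mem_univ v, hi⟩⟩
  have h1 : p ^ d ≤ ∑ i, (Z i).card := by
    calc p ^ d = (Finset.univ : Finset (Fin d → ZMod p)).card := by
            rw [Finset.card_univ, card_zmod_pow]
      _ ≤ (Finset.univ.biUnion Z).card := Finset.card_le_card hcover
      _ ≤ ∑ i, (Z i).card := Finset.card_biUnion_le
  have h2 : (∑ i, (Z i).card) * p = t * p ^ d := by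
    rw [Finset.sum_mul, Finset.sum_congr rfl (fun i _ => hZcard i), Finset.sum_const,
      Finset.card_univ, Fintype.card_fin, smul_eq_mul]
  have hpd : 0 < p ^ d := pow_pos hp.out.pos d
  have h3 : p * p ^ d ≤ t * p ^ d := by
    calc p * p ^ d = p ^ d * p := mul_comm _ _
      _ ≤ (∑ i, (Z i).card) * p := Nat.mul_le_mul_right _ h1
      _ = t * p ^ d := h2
  have h4 : p ≤ t := Nat.le_of_mul_le_mul_right h3 hpd
  omega

/-- `β_p(Ψ) > 0` for every prime `p > max(t, L)` when the forms are non-constant with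
`|coefficients| ≤ L`. -/
theorem localFactor_pos_of_lt {d t : ℕ} {p : ℕ} (hp : p.Prime) (Ψ : Fin t → AffLinForm d)
    (hΨ : ∀ i, (Ψ i).coeff ≠ 0) {L : ℕ} (hL : ∀ i k, ((Ψ i).coeff k).natAbs ≤ L)
    (hLp : L < p) (htp : t < p) : 0 < localFactor Ψ p := by
  haveI := Fact.mk hp
  have hcoeff : ∀ i, (fun k => ((Ψ i).coeff k : ZMod p)) ≠ 0 := by
    intro i h
    obtain ⟨k, hk⟩ : ∃ k, (Ψ i).coeff k ≠ 0 := by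
      by_contra h'
      push Not at h'
      exact hΨ i (funext h')
    exact intCast_zmod_ne_zero_of_natAbs_lt hk (lt_of_le_of_lt (hL i k) hLp) (congr_fun h k)
  exact (goodCount_pos_iff_localFactor_pos Ψ hp).mp (goodCount_pos_of_lt Ψ hcoeff htp)

/-- **G2, local form.**  For `primorial (max t L) ∣ j`: `β_p(Ψ) > 0 ↔ β_p(Ψ^{(i,j)}) > 0` at every
prime `p`. -/
theorem localFactor_pos_iff_shiftConst {d t L : ℕ} {Ψ : Fin t → AffLinForm d}
    (hΨ : IsNondegenerateSystem Ψ) {N : ℝ} (hL : affLinSize Ψ N ≤ L) (i : Fin t) {j : ℕ}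
    (hj : strideMod t L ∣ j) {p : ℕ} (hp : p.Prime) :
    0 < localFactor Ψ p ↔ 0 < localFactor (shiftConst Ψ i (j : ℤ)) p := by
  by_cases hpw : p ≤ max t L
  · have hpj : (p : ℤ) ∣ ((j : ℕ) : ℤ) :=
      Int.natCast_dvd_natCast.mpr ((hp.dvd_primorial_iff.mpr hpw).trans hj)
    rw [localFactor_shiftConst_eq hp Ψ i hpj]
  · push Not at hpw
    have htp : t < p := lt_of_le_of_lt (le_max_left _ _) hpw
    have hLp : L < p := lt_of_le_of_lt (le_max_right _ _) hpw
    have hb : ∀ i' k, ((Ψ i').coeff k).natAbs ≤ L := fun i' k =>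
      natAbs_coeff_le_of_affLinSize_le hL i' k
    have hb' : ∀ i' k, ((shiftConst Ψ i (j : ℤ) i').coeff k).natAbs ≤ L := by
      intro i' k
      rw [shiftConst_apply_coeff]
      exact hb i' k
    have hne' : ∀ i', (shiftConst Ψ i (j : ℤ) i').coeff ≠ 0 := by
      intro i'
      rw [shiftConst_apply_coeff]
      exact hΨ.1 i'
    exact ⟨fun _ => localFactor_pos_of_lt hp _ hne' hb' hLp htp,
      fun _ => localFactor_pos_of_lt hp _ hΨ.1 hb hLp htp⟩

/-- Admissibility of a non-degenerate system is positivity of every local factor. -/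
theorem singularProduct_pos_iff_localFactor_pos {d t : ℕ} {Φ : Fin t → AffLinForm d}
    (hΦ : IsNondegenerateSystem Φ) :
    0 < singularProduct Φ ↔ ∀ p : ℕ, p.Prime → 0 < localFactor Φ p := by
  constructor
  · intro hpos p hp
    rcases (localFactor_nonneg Φ p).lt_or_eq with h | h
    · exact h
    · exact absurd (singularProduct_eq_zero_of_localFactor_eq_zero Φ hΦ hp h.symm) hpos.ne'
  · exact singularProduct_pos_of_localFactor_pos Φ hΦ

/-- **G2 CERTIFICATE (trap T15 defused).**  For a non-degenerate `Ψ` with `‖Ψ‖_N ≤ L`, a lattice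
shift `j ∈ primorial(max t L)·ℕ` of one constant term with non-degenerate result preserves admissibility
EXACTLY: `0 < 𝔖(Ψ) ↔ 0 < 𝔖(Ψ^{(i,j)})`.  So an admissible system has no obstructed lattice comparand, and
an obstructed system has no admissible one. -/
theorem singularProduct_pos_iff_shiftConst {d t L : ℕ} {Ψ : Fin t → AffLinForm d}
    (hΨ : IsNondegenerateSystem Ψ) {N : ℝ} (hL : affLinSize Ψ N ≤ L) (i : Fin t) {j : ℕ}
    (hj : strideMod t L ∣ j) (hΨ' : IsNondegenerateSystem (shiftConst Ψ i (j : ℤ))) :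
    0 < singularProduct Ψ ↔ 0 < singularProduct (shiftConst Ψ i (j : ℤ)) := by
  rw [singularProduct_pos_iff_localFactor_pos hΨ, singularProduct_pos_iff_localFactor_pos hΨ']
  exact forall_congr' fun p => forall_congr' fun hp => localFactor_pos_iff_shiftConst hΨ hL i hj hp

/-- T15 test, first instantiation («obstructed comparand»): impossible under G2. -/
theorem no_obstructed_comparand {d t L : ℕ} {Ψ : Fin t → AffLinForm d}
    (hΨ : IsNondegenerateSystem Ψ) {N : ℝ} (hL : affLinSize Ψ N ≤ L) (hadm : 0 < singularProduct Ψ)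
    (i : Fin t) {j : ℕ} (hj : strideMod t L ∣ j)
    (hΨ' : IsNondegenerateSystem (shiftConst Ψ i (j : ℤ))) :
    0 < singularProduct (shiftConst Ψ i (j : ℤ)) :=
  (singularProduct_pos_iff_shiftConst hΨ hL i hj hΨ').mp hadm

/-- T15 test, second instantiation («obstructed system, admissible comparand»): impossible under G2. -/
theorem no_admissible_comparand_of_obstructed {d t L : ℕ} {Ψ : Fin t → AffLinForm d}
    (hΨ : IsNondegenerateSystem Ψ) {N : ℝ} (hL : affLinSize Ψ N ≤ L) (hobs : singularProduct Ψ = 0)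
    (i : Fin t) {j : ℕ} (hj : strideMod t L ∣ j)
    (hΨ' : IsNondegenerateSystem (shiftConst Ψ i (j : ℤ))) :
    singularProduct (shiftConst Ψ i (j : ℤ)) = 0 := by
  have hnn : 0 ≤ singularProduct (shiftConst Ψ i (j : ℤ)) :=
    ge_of_tendsto (tendsto_singularProductPartial_holds d t _ hΨ')
      (Filter.Eventually.of_forall fun x => Finset.prod_nonneg fun p _ => localFactor_nonneg _ p)
  rcases hnn.lt_or_eq with h | h
  · exact absurd ((singularProduct_pos_iff_shiftConst hΨ hL i hj hΨ').mpr h) (by rw [hobs]; exact lt_irrefl 0)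
  · exact h.symm

/-! ## §3 Windows on the lattice (classical instances from here on) -/

open scoped Classical

/-- `‖Ψ^{(i,j)}‖_N ≤ ‖Ψ‖_N + |j|/N`. -/
theorem affLinSize_shiftConst_le {d t : ℕ} (Ψ : Fin t → AffLinForm d) (i : Fin t) (j : ℤ)
    {N : ℕ} (hN : 0 < N) :
    affLinSize (shiftConst Ψ i j) N ≤ affLinSize Ψ N + |(j : ℝ)| / N := by
  have hN' : (0 : ℝ) < N := by exact_mod_cast hN
  have hcoeff : ∑ i', ∑ k, |((shiftConst Ψ i j i').coeff k : ℝ)|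
      = ∑ i', ∑ k, |((Ψ i').coeff k : ℝ)| := by
    refine Finset.sum_congr rfl fun i' _ => ?_
    rw [shiftConst_apply_coeff]
  have hconst : ∑ i', |((shiftConst Ψ i j i').const : ℝ) / N|
      ≤ ∑ i', |((Ψ i').const : ℝ) / N| + |(j : ℝ)| / N := by
    calc ∑ i', |((shiftConst Ψ i j i').const : ℝ) / N|
        ≤ ∑ i', (|((Ψ i').const : ℝ) / N| + if i' = i then |(j : ℝ)| / N else 0) := by
          refine Finset.sum_le_sum fun i' _ => ?_
          rw [shiftConst_apply_const]
          split_ifs with h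
          · push_cast
            rw [add_div]
            calc |((Ψ i').const : ℝ) / N + (j : ℝ) / N|
                ≤ |((Ψ i').const : ℝ) / N| + |(j : ℝ) / N| := abs_add_le _ _
              _ = |((Ψ i').const : ℝ) / N| + |(j : ℝ)| / N := by
                  rw [abs_div (j : ℝ), abs_of_pos hN']
          · simp
      _ = ∑ i', |((Ψ i').const : ℝ) / N| + |(j : ℝ)| / N := by
          rw [Finset.sum_add_distrib]
          simp
  unfold affLinSize
  rw [hcoeff]
  linarith

/-- Membership in the lattice window, unfolded. -/
theorem mem_latticeWindow {θ : ℝ} {P : ℕ} {d t : ℕ} {Ψ : Fin t → AffLinForm d} {i : Fin t}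
    {N j : ℕ} :
    j ∈ latticeWindow θ P Ψ i N ↔
      j < windowLen θ N ∧ P ∣ j ∧ IsNondegenerateSystem (shiftConst Ψ i (j : ℤ)) := by
  rw [latticeWindow, Finset.mem_filter, Finset.mem_range]

/-- The window is non-empty for `N ≥ 1`, `θ ≥ 0`. -/
theorem windowLen_pos {θ : ℝ} (hθ : 0 ≤ θ) {N : ℕ} (hN : 1 ≤ N) : 0 < windowLen θ N :=
  Nat.floor_pos.mpr (Real.one_le_rpow (by exact_mod_cast hN) hθ)

/-- `⌊N^θ⌋ ≤ N` for `θ ≤ 1`, `N ≥ 1`. -/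
theorem windowLen_le {θ : ℝ} (hθ : θ ≤ 1) {N : ℕ} (hN : 1 ≤ N) : (windowLen θ N : ℝ) ≤ N := by
  have hN' : (1 : ℝ) ≤ N := by exact_mod_cast hN
  unfold windowLen
  calc (⌊(N : ℝ) ^ θ⌋₊ : ℝ) ≤ (N : ℝ) ^ θ := Nat.floor_le (Real.rpow_nonneg (by positivity) θ)
    _ ≤ N := Real.rpow_le_self_of_one_le hN' hθ

/-- `0` lies in the lattice window of a non-degenerate system. -/
theorem zero_mem_latticeWindow {θ : ℝ} (hθ : 0 ≤ θ) (P : ℕ) {d t : ℕ} {Ψ : Fin t → AffLinForm d}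
    (hΨ : IsNondegenerateSystem Ψ) (i : Fin t) {N : ℕ} (hN : 1 ≤ N) :
    0 ∈ latticeWindow θ P Ψ i N := by
  rw [mem_latticeWindow]
  refine ⟨windowLen_pos hθ hN, dvd_zero P, ?_⟩
  rw [Nat.cast_zero, shiftConst_zero]
  exact hΨ

/-- Members of the window have size `≤ L + 1` once `‖Ψ‖_N ≤ L` (`θ ≤ 1`, `N ≥ 1`). -/
theorem affLinSize_member_le {θ : ℝ} (hθ : θ ≤ 1) {N : ℕ} (hN : 1 ≤ N) {d t : ℕ}
    (Ψ : Fin t → AffLinForm d) (i : Fin t) {j : ℕ} (hj : j ≤ windowLen θ N) {L : ℕ}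
    (hL : affLinSize Ψ N ≤ L) : affLinSize (shiftConst Ψ i (j : ℤ)) N ≤ ((L + 1 : ℕ) : ℝ) := by
  have hNr : (0 : ℝ) < N := by exact_mod_cast hN
  have h1 := affLinSize_shiftConst_le Ψ i (j : ℤ) hN
  have hj' : |((j : ℤ) : ℝ)| / N ≤ 1 := by
    rw [Int.cast_natCast, Nat.abs_cast, div_le_one hNr]
    calc (j : ℝ) ≤ windowLen θ N := by exact_mod_cast hj
      _ ≤ N := windowLen_le hθ hN
  push_cast
  linarith

end

end Summit.Parity.GeneralizedHardyLittlewood.TelescopingWindowsLatticeShift
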